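import Literature.NumberTheory.EllipticCurves.CPMuDescentCurve
import Literature.NumberTheory.EllipticCurves.MuThreeTorsorImage
import Literature.NumberTheory.EllipticCurves.ThreeKernelCocycles
import Literature.NumberTheory.EllipticCurves.IsogenyCompProofs
import Literature.NumberTheory.EllipticCurves.IsogenyVariableChangeProofs
import Literature.NumberTheory.EllipticCurves.IsogenyDualProofs
import Literature.NumberTheory.EllipticCurves.ShaIsogenyProofs
import Literature.NumberTheory.EllipticCurves.TwoIsogenyShaTwoTorsion
import Literature.NumberTheory.EllipticCurves.TorsionCardinality

/-!
# `Ш(E/K)[3] = 0` from the two sharp Selmer boxes of a `3`-isogeny with `ℤ/3`-kernel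
# (Cohen–Pazuki 2009, Prop. 2.2; Silverman X.4.2, III.6.1) — the generic assembly

Topic `NumberTheory/EllipticCurves`. Let `K` be a number field with `√−3 ∉ K`, `E = threeTorsionModel m s`
(`y² = x³ + (mx + s)²`, rational `3`-torsion point `T = (0, s)`), `Ê = threeIsogenyCodomain m s` its Vélu
quotient, and `V = cpCurve a b` (`y² = x³ − 3(ax + b)²`, Cohen–Pazuki's `μ₃`-model, kernel `T̂ = (0, b√−3)`)
a model of `Ê`: `cpCurve a b = C • Ê`. The `3`-isogeny descent decides `Ш(E/K)[3]` from TWO Selmer boxes: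

* the `φ̂`-side («`Ш(V/K) ∩ ker ψ_* = 0`»): every locally trivial `μ₃`-torsor class of `V` killed by an
  equivariant surjection with kernel `⟨T̂⟩` vanishes — supplied curve by curve from the SHARP `α`-box of `E`
  through `CPMuDescentGlobal.torsorClassQuotHom_eq_one_of_mem_closure` (e.g. `Curve6137MuDescentSelmer`);
* the `φ`-side («`Ш(E/K) ∩ ker φ_* = 0`»): supplied from the sharp `α̂`-box over `K(√−3)` through
  `ThreeKernelCocycles` + `K3CubicCharacterNorm` (e.g. `Curve6137PhiSideSelmer`).

This file is the curve-independent last step (extracted from `Curve6137ShaThree`):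

* `cpCurve_eq_variableChange_threeIsogenyCodomain` — the canonical model
  `cpCurve m (3s − 4m³/9) = ⟨1, −4m²/3, 0, 0⟩ • threeIsogenyCodomain m s` (all `m, s`);
* `IsVeluThreePair.smul_geomT` — `T = (0, s)` is `Γ_K`-fixed; `exists_galAut_theta_ne` — `√−3` is moved;
* **`forall_mem_sha_three_nsmul_eq_zero_of_sharp`** — the two boxes sharp ⇒ `Ш(E/K)[3] = 0`: with
  `φ' = (C ≅) ∘ Vélu : E → V` (an `Isogeny` of degree `3`) and its dual `ψ` (`ψ ∘ φ' = [3]`,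
  `Isogeny.exists_dual_of_isElliptic`), `ker ψ = ⟨T̂⟩` (`ψ(T̂) = O` by the `ε`-trick
  `MuThreeKernel.apply_T_eq_zero_of_fixed`, and `#E[3] = 9`, `card_torsionBy_eq_sq`), so `c ∈ Ш(E)`, `3c = 0`
  ⇒ `φ'_* c ∈ Ш(V) ∩ ker ψ_* = 0` ⇒ `φ_* c = 0` ⇒ `c = 0`;
* `primaryComponent_sha_three_eq_bot_of_sharp`, **`shaCorank_three_eq_zero_of_sharp`** — `Ш[3^∞] = ⊥`, `t_3 = 0`.

## References

* [CohenPazuki2009] H. Cohen, F. Pazuki, Acta Arith. 140 (2009), Prop. 1.4, Thm. 2.1, Prop. 2.2.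
* [SilvermanAEC2009] J. H. Silverman, *AEC*, Thm. III.6.1–6.2, Cor. III.6.4, Thm. X.4.2.
-/

noncomputable section

open scoped Classical

open WeierstrassCurve

universe u

namespace Literature.NumberTheory.EllipticCurves

open MordellDescent MuThreeKernel GaloisRepresentations

/-! ## The canonical Cohen–Pazuki model of the Vélu quotient -/

namespace CPMuDescent

variable {K : Type u} [Field K] [CharZero K]

/-- **The Vélu quotient in Cohen–Pazuki form**: translating `Ê = threeIsogenyCodomain m s` by `x ↦ x − 4m²/3`
gives `cpCurve m (3s − 4m³/9) : y² = x³ − 3(mx + 3s − 4m³/9)²`. [cite: CohenPazuki2009, §1.2 and Proposition 2.2] -/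
theorem cpCurve_eq_variableChange_threeIsogenyCodomain (m s : K) :
    cpCurve m (3 * s - 4 * m ^ 3 / 9) =
      (⟨1, -(4 * m ^ 2 / 3), 0, 0⟩ : VariableChange K) • threeIsogenyCodomain m s := by
  ext
  · simp [cpCurve, threeIsogenyCodomain, variableChange_a₁]
  · simp only [cpCurve, threeIsogenyCodomain, variableChange_a₂, Units.val_one, inv_one, one_pow, one_mul,
      mul_zero, sub_zero]
    field_simp
    ring
  · simp [cpCurve, threeIsogenyCodomain, variableChange_a₃]
  · simp only [cpCurve, threeIsogenyCodomain, variableChange_a₄, Units.val_one, inv_one, one_pow, one_mul,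
      mul_zero, sub_zero, add_zero]
    field_simp
    ring
  · simp only [cpCurve, threeIsogenyCodomain, variableChange_a₆, Units.val_one, inv_one, one_pow, one_mul,
      mul_zero, sub_zero]
    field_simp
    ring

/-- `b̂ = 3s − 4m³/9 ≠ 0` when `E_{m,s}` is elliptic (`4m³ ≠ 27s`). [cite: CohenPazuki2009, §1.2] -/
theorem canonical_b_ne_zero {m s : K} [hE : (threeTorsionModel m s).IsElliptic] : 3 * s - 4 * m ^ 3 / 9 ≠ 0 := by
  have h := (isElliptic_threeTorsionModel_iff m s).mp hE
  intro h0
  apply h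
  have : 4 * m ^ 3 - 27 * s = 0 := by field_simp at h0; linear_combination -h0
  rw [this, mul_zero]

/-- `4m³ + 9b̂ = 27s ≠ 0` when `E_{m,s}` is elliptic (`s ≠ 0`). [cite: CohenPazuki2009, §1.2] -/
theorem canonical_d_ne_zero {m s : K} [hE : (threeTorsionModel m s).IsElliptic] :
    4 * m ^ 3 + 9 * (3 * s - 4 * m ^ 3 / 9) ≠ 0 := by
  have h := (isElliptic_threeTorsionModel_iff m s).mp hE
  intro h0
  apply h
  have : s = 0 := by field_simp at h0; linear_combination h0 / 27
  rw [this]; ring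

end CPMuDescent

/-! ## Two Galois facts -/

section Galois

variable {K : Type u} [Field K] [CharZero K]

omit [CharZero K] in
/-- **The rational `3`-torsion point `T = (0, s)` of a Vélu pair is `Γ_K`-fixed.** [cite: SilvermanAEC2009, III.§4 (Vélu)] -/
theorem _root_.WeierstrassCurve.IsVeluThreePair.smul_geomT {m s : K} {W W' : WeierstrassCurve K} (hV : IsVeluThreePair m s W W')
    (σ : Field.absoluteGaloisGroup K) : σ • hV.geomT = hV.geomT := by
  change σ • (show geomPoints W from hV.geom.T) = hV.geom.T
  rw [IsVeluThreePair.T, MordellDescent.smul_geomPoints_some σ _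
    (MordellDescent.nonsingular_galAut σ hV.geom.nonsingular_T)]
  exact MordellDescent.point_some_ext (map_zero _) (AlgEquiv.commutes _ _)

/-- **If `−3` is not a square in `K`, some `σ₀ ∈ Γ_K` moves `√−3`.** [cite: CohenPazuki2009, §1.2] -/
theorem exists_galAut_theta_ne (hK : ∀ q : K, q ^ 2 ≠ -3) :
    ∃ σ₀ : Field.absoluteGaloisGroup K, MordellDescent.galAut σ₀ (MordellDescent.theta K) ≠ MordellDescent.theta K := by
  by_contra h
  push Not at h
  obtain ⟨q, hq⟩ := MordellDescent.exists_algebraMap_eq_of_forall_galAut (K := K) h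
  have key : ∀ f : K →+* AlgebraicClosure K, f q = MordellDescent.theta K → False := by
    intro f hf
    have h2 : f (q ^ 2 + 3) = 0 := by
      rw [map_add, map_pow, hf, MordellDescent.theta_sq, map_ofNat]; norm_num
    have h3 : q ^ 2 + 3 = 0 := (map_eq_zero_iff f f.injective).mp h2
    exact hK q (by linear_combination h3)
  exact key _ hq

end Galois

/-! ## The assembly -/

namespace CPMuDescent

variable {K : Type u} [Field K] [NumberField K]

/-- The `μ₃`-kernel datum and a sharp-box statement transported along an equality of curves (private).
[cite: CohenPazuki2009, Theorem 2.1] -/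
private theorem transport_sharp {a b : K} (hb : b ≠ 0) (hd : 4 * a ^ 3 + 9 * b ≠ 0) {X : WeierstrassCurve K}
    (hX : cpCurve a b = X)
    (hhat : ∀ {W' : WeierstrassCurve K} (f : geomPoints (cpCurve a b) →+ geomPoints W')
        (hf : ∀ (σ : Field.absoluteGaloisGroup K) (P : geomPoints (cpCurve a b)), f (σ • P) = σ • f P),
        Function.Surjective f →
          (∀ P, f P = 0 → P = 0 ∨ P = (kernelDatum hb hd).T ∨ P = -(kernelDatum hb hd).T) →
            ∀ {c : (cpCurve a b).galH1}, c ∈ (cpCurve a b).sha → galH1Map f hf c = 0 → c = 0) :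
    ∃ 𝒯 : MuThreeKernel X,
      ∀ {W' : WeierstrassCurve K} (f : geomPoints X →+ geomPoints W')
        (hf : ∀ (σ : Field.absoluteGaloisGroup K) (P : geomPoints X), f (σ • P) = σ • f P),
        Function.Surjective f → (∀ P, f P = 0 → P = 0 ∨ P = 𝒯.T ∨ P = -𝒯.T) →
          ∀ {c : X.galH1}, c ∈ X.sha → galH1Map f hf c = 0 → c = 0 := by
  subst hX
  exact ⟨kernelDatum hb hd, fun f hf hsurj hker _ hc h0 => hhat f hf hsurj hker hc h0⟩

/-- **`Ш(E/K)[3] = 0` from the two sharp boxes of the `3`-isogeny descent** (`E = threeTorsionModel m s`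
over a number field `K ∌ √−3`, `cpCurve a b = C • Ê` a Cohen–Pazuki model of the Vélu quotient):
if (φ̂-side) every class of `Ш(V/K)` killed by an equivariant surjection with kernel `⟨T̂⟩` vanishes, and
(φ-side) every class of `Ш(E/K)` killed by Vélu's `φ_*` vanishes, then every class of `Ш(E/K)` killed by `3`
vanishes — `ψ ∘ φ' = [3]` for `φ' = (C ≅) ∘ φ` and its dual `ψ`, whose kernel is `⟨T̂⟩`.
[cite: CohenPazuki2009, Proposition 2.2] [cite: SilvermanAEC2009, Thm. X.4.2 (a) and Thm. III.6.1] -/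
theorem forall_mem_sha_three_nsmul_eq_zero_of_sharp (hK : ∀ q : K, q ^ 2 ≠ -3) {m s a b : K}
    [(threeTorsionModel m s).IsElliptic] (hb : b ≠ 0) (hd : 4 * a ^ 3 + 9 * b ≠ 0) (C : VariableChange K)
    (hX : cpCurve a b = C • threeIsogenyCodomain m s)
    (hhat : ∀ {W' : WeierstrassCurve K} (f : geomPoints (cpCurve a b) →+ geomPoints W')
        (hf : ∀ (σ : Field.absoluteGaloisGroup K) (P : geomPoints (cpCurve a b)), f (σ • P) = σ • f P),
        Function.Surjective f →
          (∀ P, f P = 0 → P = 0 ∨ P = (kernelDatum hb hd).T ∨ P = -(kernelDatum hb hd).T) →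
            ∀ {c : (cpCurve a b).galH1}, c ∈ (cpCurve a b).sha → galH1Map f hf c = 0 → c = 0)
    (hphi : ∀ (hV : IsVeluThreePair m s (threeTorsionModel m s) (threeIsogenyCodomain m s))
        {c : (threeTorsionModel m s).galH1}, c ∈ (threeTorsionModel m s).sha →
          galH1Map hV.geomHom hV.geomHom_smul c = 0 → c = 0) :
    ∀ c ∈ (threeTorsionModel m s).sha, 3 • c = 0 → c = 0 := by
  intro c hc h3c
  haveI : (threeIsogenyCodomain m s).IsElliptic := isElliptic_threeIsogenyCodomain
  have hV : IsVeluThreePair m s (threeTorsionModel m s) (threeIsogenyCodomain m s) :=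
    isVeluThreePair_threeTorsionModel (threeTorsionModel m s).isUnit_Δ.ne_zero
  set X : WeierstrassCurve K := C • threeIsogenyCodomain m s with hXdef
  -- the isogeny `φ' : E → X` and its dual `ψ`
  set φ' : Isogeny (threeTorsionModel m s) X :=
    (VariableChange.toIsogeny (threeIsogenyCodomain m s) C).comp hV.toIsogeny with hφ'
  have hφ'apply : ∀ P, φ' P = VariableChange.toIsogeny _ C (hV.toIsogeny P) := fun P => rfl
  have hdeg : φ'.degree = 3 := by
    rw [← hV.degree_toIsogeny]
    unfold Isogeny.degree
    congr 1
    rw [hφ', Isogeny.ker_comp, VariableChange.ker_toIsogeny]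
    rfl
  obtain ⟨ψ, hψ⟩ := φ'.exists_dual_of_isElliptic
  rw [hdeg] at hψ
  have hψφ : ∀ P, ψ.toAddMonoidHom (φ'.toAddMonoidHom P) = ((3 : ℕ) : ℤ) • P := fun P => hψ P
  have hφ'surj : Function.Surjective φ' := fun Q => by
    obtain ⟨R, rfl⟩ := VariableChange.toIsogeny_surjective _ C Q
    obtain ⟨P, rfl⟩ := hV.geom.pointFun_surjective R
    exact ⟨P, rfl⟩
  have hφψ : ∀ Q, φ' (ψ Q) = ((3 : ℕ) : ℤ) • Q := fun Q => by
    obtain ⟨P, rfl⟩ := hφ'surj Q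
    rw [hψ, map_zsmul]
  -- the kernel datum `T̂` of `X` and the sharp descent, transported from `cpCurve`
  obtain ⟨𝒯, hsharp⟩ := transport_sharp hb hd hX @hhat
  -- `ker φ' = {O, ±T}` and its points are `Γ_K`-fixed
  have hkerφ' : ∀ P, φ' P = 0 ↔ P = 0 ∨ P = hV.geomT ∨ P = -hV.geomT := by
    intro P
    rw [hφ'apply, ← map_zero (VariableChange.toIsogeny (threeIsogenyCodomain m s) C),
      (VariableChange.toIsogeny_injective _ C).eq_iff, IsVeluThreePair.toIsogeny_apply]
    exact hV.geom.pointFun_eq_zero_iff P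
  -- `ψ(T̂) = O`
  have hψT : ψ 𝒯.T = 0 := by
    obtain ⟨σ₀, hσ₀⟩ := exists_galAut_theta_ne hK
    refine 𝒯.apply_T_eq_zero_of_fixed ψ.toAddMonoidHom ψ.equivariant (fun σ => ?_) ?_ hσ₀
    · -- `φ'(ψ T̂) = 3 T̂ = O`, so `ψ T̂ ∈ {O, ±T}` is rational
      have h0 : φ' (ψ 𝒯.T) = 0 := by
        rw [hφψ, natCast_zsmul, 𝒯.three_nsmul_T]
      rcases (hkerφ' _).mp h0 with h | h | h
      · change σ • ψ 𝒯.T = ψ 𝒯.T; rw [h, smul_zero]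
      · change σ • ψ 𝒯.T = ψ 𝒯.T; rw [h, hV.smul_geomT]
      · change σ • ψ 𝒯.T = ψ 𝒯.T; rw [h, smul_neg, hV.smul_geomT]
    · change (3 : ℕ) • ψ 𝒯.T = 0
      rw [← map_nsmul, 𝒯.three_nsmul_T, map_zero]
  -- `E[3] = {iT + jR₁}` with `φ'(R₁) = T̂`: nine points, `#E[3] = 9`
  obtain ⟨R₁, hR₁⟩ := hφ'surj 𝒯.T
  have h3R₁ : (3 : ℕ) • R₁ = 0 := by
    have := hψ R₁
    rw [hR₁, hψT] at this
    rw [← natCast_zsmul]; exact this.symm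
  have hTT : hV.geomT + hV.geomT = -hV.geomT := hV.geom.T_add_T
  have h3T : (3 : ℕ) • hV.geomT = 0 := by
    rw [succ_nsmul, two_nsmul, hTT, neg_add_cancel]
  have himage : ∀ Q : geomPoints (threeTorsionModel m s), (3 : ℕ) • Q = 0 →
      φ' Q = 0 ∨ φ' Q = 𝒯.T ∨ φ' Q = -𝒯.T := by
    -- the map `(i, j) ↦ iT + jR₁` is a bijection `ℤ/3 × ℤ/3 → E[3]`
    set S := AddSubgroup.torsionBy (geomPoints (threeTorsionModel m s)) ((3 : ℕ) : ℤ) with hS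
    have hmem : ∀ Q, Q ∈ S ↔ (3 : ℕ) • Q = 0 := fun Q => AddSubgroup.torsionBy.nsmul_iff
    obtain ⟨ι₀, hι₀⟩ : ∃ ι₀ : ZMod 3 × ZMod 3 → geomPoints (threeTorsionModel m s),
        ∀ ij, ι₀ ij = ij.1.val • hV.geomT + ij.2.val • R₁ := ⟨_, fun _ => rfl⟩
    have hι₀S : ∀ ij, ι₀ ij ∈ S := fun ij => (hmem _).mpr (by
      rw [hι₀, nsmul_add, smul_comm (3 : ℕ) ij.1.val, smul_comm (3 : ℕ) ij.2.val, h3T, h3R₁, smul_zero,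
        smul_zero, add_zero])
    obtain ⟨ι, hι⟩ : ∃ ι : ZMod 3 × ZMod 3 → S, ∀ ij, (ι ij : geomPoints _) = ι₀ ij :=
      ⟨fun ij => ⟨ι₀ ij, hι₀S ij⟩, fun _ => rfl⟩
    have hφ'ι : ∀ ij : ZMod 3 × ZMod 3, φ' (ι₀ ij) = ij.2.val • 𝒯.T := by
      intro ij
      rw [hι₀, map_add, map_nsmul, map_nsmul, (hkerφ' _).mpr (Or.inr (Or.inl rfl)), smul_zero, zero_add, hR₁]
    have hιinj : Function.Injective ι := by
      intro ij ij' h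
      have h' : ι₀ ij = ι₀ ij' := by rw [← hι, ← hι, h]
      have h2 : ij.2 = ij'.2 := by
        have := congrArg φ' h'
        rw [hφ'ι, hφ'ι] at this
        exact val_nsmul_injective 𝒯.T 𝒯.T_ne_zero 𝒯.T_add_T this
      have h1 : ij.1 = ij'.1 := by
        rw [hι₀, hι₀, h2] at h'
        exact val_nsmul_injective hV.geomT hV.geomT_ne_zero hTT (add_right_cancel h')
      exact Prod.ext h1 h2
    haveI : CharZero (AlgebraicClosure K) :=
      charZero_of_injective_algebraMap (algebraMap K (AlgebraicClosure K)).injective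
    have e : Nat.card S = 3 ^ 2 :=
      card_torsionBy_eq_sq (E := (threeTorsionModel m s).baseChange (AlgebraicClosure K)) (n := 3) (by norm_num)
    have hcard : Nat.card S ≤ Nat.card (ZMod 3 × ZMod 3) := by
      rw [e, Nat.card_prod, Nat.card_zmod]; norm_num
    haveI : Finite S := Nat.finite_of_card_ne_zero (by rw [e]; norm_num)
    have hιbij : Function.Bijective ι := hιinj.bijective_of_nat_card_le hcard
    intro Q hQ
    obtain ⟨ij, hij⟩ := hιbij.2 ⟨Q, (hmem Q).mpr hQ⟩
    have hQ' : Q = ι₀ ij := by rw [← hι, hij]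
    rw [hQ', hφ'ι]
    have := ij.2.val_lt
    rcases (by omega : ij.2.val = 0 ∨ ij.2.val = 1 ∨ ij.2.val = 2) with h | h | h
    · exact Or.inl (by rw [h, zero_nsmul])
    · exact Or.inr (Or.inl (by rw [h, one_nsmul]))
    · exact Or.inr (Or.inr (by rw [h, two_nsmul, 𝒯.T_add_T]))
  have hkerψ : ∀ P : geomPoints X, ψ.toAddMonoidHom P = 0 → P = 0 ∨ P = 𝒯.T ∨ P = -𝒯.T := by
    intro P hP
    obtain ⟨Q, rfl⟩ := hφ'surj P
    have h3Q : (3 : ℕ) • Q = 0 := by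
      rw [← natCast_zsmul, ← hψ Q]; exact hP
    exact himage Q h3Q
  -- `φ'_* c ∈ Ш(X) ∩ ker ψ_* = 0`
  have hc₁ : galH1Map φ'.toAddMonoidHom φ'.equivariant c ∈ X.sha :=
    galH1Map_mem_sha φ'.toAddMonoidHom φ'.equivariant φ'.hasLocalPointsMaps_toAddMonoidHom hc
  have hψc₁ : galH1Map ψ.toAddMonoidHom ψ.equivariant (galH1Map φ'.toAddMonoidHom φ'.equivariant c) = 0 := by
    rw [galH1Map_galH1Map_of_comp_eq_nsmul φ'.toAddMonoidHom φ'.equivariant ψ.toAddMonoidHom ψ.equivariant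
      hψφ c, h3c]
  have hc₁0 : galH1Map φ'.toAddMonoidHom φ'.equivariant c = 0 :=
    hsharp ψ.toAddMonoidHom ψ.equivariant ψ.surjective hkerψ hc₁ hψc₁
  -- hence `φ_* c = 0` (the translation `Ê ≅ X` is injective on `H¹`)
  have hφc : galH1Map hV.geomHom hV.geomHom_smul c = 0 := by
    set ι₂ := VariableChange.toIsogeny (threeIsogenyCodomain m s) C with hι₂
    let g : geomPoints X →+ geomPoints (threeIsogenyCodomain m s) :=
      (VariableChange.pointEquivBaseChange (threeIsogenyCodomain m s) C (AlgebraicClosure K)).symm.toAddMonoidHom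
    have hgι' : ∀ P : geomPoints (threeIsogenyCodomain m s), g (ι₂ P) = P :=
      fun P => (VariableChange.pointEquivBaseChange (threeIsogenyCodomain m s) C
        (AlgebraicClosure K)).symm_apply_apply P
    have hg : ∀ (σ : Field.absoluteGaloisGroup K) (Q : geomPoints X), g (σ • Q) = σ • g Q := by
      intro σ Q
      obtain ⟨P, rfl⟩ : ∃ P : geomPoints (threeIsogenyCodomain m s), ι₂ P = Q :=
        VariableChange.toIsogeny_surjective _ C Q
      rw [← ι₂.map_smul σ P, hgι', hgι']
    have hgι : ∀ P, g (ι₂.toAddMonoidHom P) = ((1 : ℕ) : ℤ) • P := fun P => by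
      rw [Nat.cast_one, one_zsmul]
      exact hgι' P
    have e : galH1Map φ'.toAddMonoidHom φ'.equivariant c =
        galH1Map ι₂.toAddMonoidHom ι₂.equivariant (galH1Map hV.geomHom hV.geomHom_smul c) := by
      rw [galH1Map_galH1Map]; rfl
    have := galH1Map_galH1Map_of_comp_eq_nsmul ι₂.toAddMonoidHom ι₂.equivariant g hg hgι
      (galH1Map hV.geomHom hV.geomHom_smul c)
    rw [← e, hc₁0, map_zero, one_nsmul] at this
    exact this.symm
  exact hphi hV hc hφc

/-- **`Ш(E/K)[3^∞] = ⊥` from the two sharp boxes.** [cite: CohenPazuki2009, Proposition 2.2] -/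
theorem primaryComponent_sha_three_eq_bot_of_sharp (hK : ∀ q : K, q ^ 2 ≠ -3) {m s a b : K}
    [(threeTorsionModel m s).IsElliptic] (hb : b ≠ 0) (hd : 4 * a ^ 3 + 9 * b ≠ 0) (C : VariableChange K)
    (hX : cpCurve a b = C • threeIsogenyCodomain m s)
    (hhat : ∀ {W' : WeierstrassCurve K} (f : geomPoints (cpCurve a b) →+ geomPoints W')
        (hf : ∀ (σ : Field.absoluteGaloisGroup K) (P : geomPoints (cpCurve a b)), f (σ • P) = σ • f P),
        Function.Surjective f →
          (∀ P, f P = 0 → P = 0 ∨ P = (kernelDatum hb hd).T ∨ P = -(kernelDatum hb hd).T) →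
            ∀ {c : (cpCurve a b).galH1}, c ∈ (cpCurve a b).sha → galH1Map f hf c = 0 → c = 0)
    (hphi : ∀ (hV : IsVeluThreePair m s (threeTorsionModel m s) (threeIsogenyCodomain m s))
        {c : (threeTorsionModel m s).galH1}, c ∈ (threeTorsionModel m s).sha →
          galH1Map hV.geomHom hV.geomHom_smul c = 0 → c = 0) :
    AddCommGroup.primaryComponent (threeTorsionModel m s).sha 3 = ⊥ :=
  primaryComponent_sha_eq_bot_of_forall _ (forall_mem_sha_three_nsmul_eq_zero_of_sharp hK hb hd C hX @hhat hphi)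

/-- **`t_3(E) = corank_{ℤ₃} Ш(E/K)[3^∞] = 0` from the two sharp boxes** — the complete `3`-isogeny descent
criterion, kernel-checked; a cross-prime cell of an explicit curve needs exactly its two box statements.
[cite: CohenPazuki2009, Proposition 2.2] [cite: SilvermanAEC2009, Thm. X.4.2 (a)] -/
theorem shaCorank_three_eq_zero_of_sharp (hK : ∀ q : K, q ^ 2 ≠ -3) {m s a b : K}
    [(threeTorsionModel m s).IsElliptic] (hb : b ≠ 0) (hd : 4 * a ^ 3 + 9 * b ≠ 0) (C : VariableChange K)
    (hX : cpCurve a b = C • threeIsogenyCodomain m s)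
    (hhat : ∀ {W' : WeierstrassCurve K} (f : geomPoints (cpCurve a b) →+ geomPoints W')
        (hf : ∀ (σ : Field.absoluteGaloisGroup K) (P : geomPoints (cpCurve a b)), f (σ • P) = σ • f P),
        Function.Surjective f →
          (∀ P, f P = 0 → P = 0 ∨ P = (kernelDatum hb hd).T ∨ P = -(kernelDatum hb hd).T) →
            ∀ {c : (cpCurve a b).galH1}, c ∈ (cpCurve a b).sha → galH1Map f hf c = 0 → c = 0)
    (hphi : ∀ (hV : IsVeluThreePair m s (threeTorsionModel m s) (threeIsogenyCodomain m s))
        {c : (threeTorsionModel m s).galH1}, c ∈ (threeTorsionModel m s).sha →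
          galH1Map hV.geomHom hV.geomHom_smul c = 0 → c = 0) :
    (threeTorsionModel m s).shaCorank 3 = 0 :=
  haveI : Fact (Nat.Prime 3) := ⟨Nat.prime_three⟩
  shaCorank_eq_zero_of_forall _ 3 (forall_mem_sha_three_nsmul_eq_zero_of_sharp hK hb hd C hX @hhat hphi)

end CPMuDescent

end Literature.NumberTheory.EllipticCurves

end
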